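import Summits.BirchSwinnertonDyer.Rank1Residual.Ordinary.Conjectures.KolyvaginClassDatum
import Summits.BirchSwinnertonDyer.Rank1Residual.X11b.KummerRelaxedStructures
import Literature.NumberTheory.GaloisCohomology.KolyvaginSystems
import HarnessLib

/-!
# The Kolyvagin-class datum FROM A KOLYVAGIN SYSTEM: «SOME comparison isomorphism θ» becomes «THE finite–singular
# comparison map `φ^{fs}_ℓ` of an admissible Kolyvagin datum» (theorems only; nothing asserted; C-16 stays a CONJECTURE)

HONEST FRAMING (cell `b2b-bsdres`, run/shared/lean/b2b/bsd-rank1-residual/, verbatim in every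
file): the goal of the cell is to DELETE the COMBINATION-SHAPED residual classes of the
Birch–Swinnerton-Dyer formula for ALL analytic-rank `≤ 1` elliptic curves over `ℚ` — "full BSD
formula for every rank `≤ 1` curve in class `C`" assembled STRICTLY from published theorems — so
that the rank-`≤ 1` remainder becomes exactly the CONSTRUCTION-SHAPED classes, which are TYPED
(missing-input `Prop`s), NOT attempted. This is not "finishing BSD". Seat `b2b-bsdres-additive-p3`
(X8 prover B / X7 joint; typer-designate for the cell conjecture C-16 = hyp C120.1 by hyp R-16 (e); ladder BSD:K3
hand-off to cell `bsd-ssimc`). This file books nothing and moves no mark; X7 / X8 stay CONSTRUCTION-SHAPED; C-16 = CONJECTURE.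

## What this file does

`Conjectures/KolyvaginClassDatum.lean` typed the one remaining input of the depth-law / C-16 derivation as
`KolyvaginKimDatum W f p ℓ k n Q vℓ vp ψ`: a class `x ∈ H¹(ℚ, E[p^n])` Kummer outside `{vℓ, vp}` whose singular part at
`vℓ` is `θ[loc_{vℓ} κ(Q)]` for SOME additive isomorphism `θ : 𝓛_{vℓ} ≅ H¹(ℚ_{vℓ}, E[p^n]) ⧸ 𝓛_{vℓ}`, plus Kim's reading.
This file replaces «SOME `θ`» by THE comparison map of the tree's Kolyvagin-system vocabulary
(`Literature/NumberTheory/GaloisCohomology/KolyvaginSystems.lean`: `KolyvaginDatum`, `IsKolyvaginSystem`,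
`IsAdmissible`; `FiniteSingularComparison.lean`: `HasCanonicalComparison`):

* §1 (algebra) `KSDatum.exists_addEquiv_transport`: an additive map `fs : A → A ⧸ U` bijective on `U` and an equality
  of subgroups `L = U` give THE transported identification `θ : L ≅ A ⧸ L`, `θ y = (fs y viewed in A ⧸ L)`; under it a
  relation `[a] = fs y` in `A ⧸ U` reads `[a] = θ y` in `A ⧸ L` (`KSDatum.mk_eq_of_mk_eq`).
* §2 `kolyvaginKimDatum_of_singularMap_eq`: at a good place `vℓ ∤ p` the local Kummer condition `𝓛_{vℓ}` of `E[p^n]` IS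
  `H¹_ur(ℚ_{vℓ}, E[p^n])` (tree `X11b.KummerPT.kummerSelmerStructure_inr_eq_unramifiedSubgroup`, AEC X.4.4 / Milne I 3.8),
  so for ANY comparison map `fs : H¹(ℚ_{vℓ}, E[p^n]) → H¹_{/ur}` bijective on `H¹_ur` (an ADMISSIBLE `φ^{fs}_ℓ`,
  Mazur–Rubin Lemma 1.2.3 / Rubin Ex. 1.9.7 — a THEOREM of the tree for the canonical map at Sakamoto's primes,
  `GaloisImage/CanonicalKolyvaginDatumAdmissible*.lean`), a class `x` Kummer outside `{vℓ, vp}` with the printed KS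
  relation `loc^s_{vℓ} x = fs(loc_{vℓ} κ(Q))` and Kim's reading IS a `KolyvaginKimDatum` — with `θ` THE transport of `fs`.
* §3 `kolyvaginKimDatum_of_isKolyvaginSystem`: for a Kolyvagin datum `D` on `E[p^n]` with `vℓ ∈ 𝒫` and `φ^{fs}_{vℓ}`
  bijective on `H¹_ur` (`D.IsAdmissible` suffices, `…_of_isAdmissible`), a Selmer structure `𝓕` that is Kummer-or-finer
  at every place `∉ {vℓ, vp}` (the shape of `𝓕_can` on `E[p^n]`: unramified = Kummer at good `v ∤ p`, the Kummer image at
  `v ∣ N`, Mazur–Rubin Def. 3.2.1 / Prop. 3.5.8 ff.; for the Kummer structure relaxed at `vp` it is automatic,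
  `…_of_isKolyvaginSystem_kummer`), and a KOLYVAGIN SYSTEM `κ ∈ KS(E[p^n], 𝓕, D)` (`IsKolyvaginSystem`) with bottom class
  `κ_1 = κ(Q)`: the class `κ_{ℓ}` with Kim's reading IS a `KolyvaginKimDatum` (the KS relation
  `v_ℓ(κ_{ℓ}) = φ^{fs}_ℓ(κ_1)` is `IsKolyvaginSystem.fs_rel` at the empty level).
* §4 the closed sentence in this currency, `kuriharaExactOrderRankOneAtThree_of_isKolyvaginSystem`:
  **C-16 ⟸ (Poitou–Tate over `ℚ`) ∧ (local Euler characteristic at every `ℚ_v`) ∧ (∀ letter ∀ ψ ∃ n ≥ k with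
  `ℓ ∈ 𝒫_n`, ∃ u with `3 ∤ u`, ∃ an admissible-at-`vℓ` Kolyvagin datum `D ∋ vℓ` on `E[3^n]`, a Selmer structure Kummer
  off `{vℓ, v₃}` and a Kolyvagin system `κ` for it with `κ_1 = κ((3^F·u)·P)` whose class `κ_{ℓ}` has Kim's reading)**
  — the ONE open input of C-16 now displayed in the vocabulary in which Kato's Euler system ⇒ Kolyvagin system
  (Mazur–Rubin Thm. 3.2.4 with Thm. 5.2.12, `κ_1 = p^a u·P`) and Kim's Thm. 3.13 are printed (for `p ≥ 5`; OPEN at `3`).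

Currency note for consumers: this chain's module is `W.torsionGaloisModule ((p ^ n : ℕ) : ℤ)`; team n1011's canonical
datum / Theorem D files (`GaloisImage/CanonicalKolyvaginDatum*.lean`, `KolyvaginSystemOfEulerSystem.lean`) use the
modulus spelled `(p : ℤ) ^ k * p`; the junction is a coefficient transport, not done here.

References: B. Mazur, K. Rubin, Mem. AMS 799 (2004), Def. 1.2.2, Lemma 1.2.3, Def. 3.2.1, Thm. 3.2.4, Thm. 5.2.12
[MazurRubin2004]; K. Rubin, PCMI 18 (2011) Def. 1.9.6, Ex. 1.9.7, Def. 2.2.1 [Rubin2011]; C.-H. Kim, arXiv:2203.12159,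
§2.1.2, §2.2.2, Thm. 3.13, (5.3) [Kim2022StructureSelmer]; R. Sakamoto, JTNB 36 (2024) Def. 4.1 [Sakamoto2024];
J. H. Silverman, AEC (2009) X.4.4 [SilvermanAEC2009]; J. S. Milne, ADT (2006) I 2.8, 3.8, 4.10(b) [MilneADT2006];
`HOME/b2b-bsdres-additive-p3/KS-LAYER-SPEC.md`.
-/

noncomputable section

open scoped Classical MatrixGroups ModularForm

open CongruenceSubgroup WeierstrassCurve Literature.NumberTheory.EllipticCurves
  Literature.NumberTheory.EllipticCurves.ModularForms
  Literature.NumberTheory.EllipticCurves.Rank1Residual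
  Literature.NumberTheory.GaloisRepresentations Literature.NumberTheory.GaloisCohomology
  Literature.NumberTheory.GaloisRepresentations.DiscreteGaloisModule
  Function NumberField IsDedekindDomain

namespace Summit.BirchSwinnertonDyer.Rank1Residual.Ordinary

/-! ### §1 Algebra: transporting an admissible comparison map along an equality of local conditions -/

section Transport

variable {A : Type*} [AddCommGroup A] {L U : AddSubgroup A}

/-- **THE transported identification.** For subgroups `L = U` of `A` and an additive map `fs : A → A ⧸ U` whose
restriction to `U` is a bijection onto `A ⧸ U` (an admissible finite–singular comparison map, Mazur–Rubin Lemma 1.2.3),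
there is an additive isomorphism `θ : L ≅ A ⧸ L` with `θ y = fs y` read in `A ⧸ L` (through `A ⧸ U = A ⧸ L`); it is
determined by `fs`. [cite: MazurRubin2004, Def. 1.2.2 and Lemma 1.2.3] -/
theorem KSDatum.exists_addEquiv_transport (hLU : L = U) (fs : A →+ A ⧸ U)
    (hbij : Function.Bijective fun y : U => fs y) :
    ∃ θ : L ≃+ A ⧸ L, ∀ y : L, θ y = QuotientAddGroup.quotientAddEquivOfEq hLU.symm (fs y) := by
  have hbij' : Function.Bijective (fs.comp U.subtype) := hbij
  refine ⟨(AddEquiv.addSubgroupCongr hLU).trans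
      ((AddEquiv.ofBijective (fs.comp U.subtype) hbij').trans (QuotientAddGroup.quotientAddEquivOfEq hLU.symm)),
    fun y => ?_⟩
  rw [AddEquiv.trans_apply, AddEquiv.trans_apply, AddEquiv.ofBijective_apply, AddMonoidHom.comp_apply,
    AddSubgroup.coe_subtype, AddEquiv.addSubgroupCongr_apply]

/-- **Under the transported identification the KS relation keeps its shape**: if `θ y = fs y` (read in `A ⧸ L`) for
all `y ∈ L`, then `[a] = fs y` in `A ⧸ U` gives `[a] = θ y` in `A ⧸ L`. [cite: MazurRubin2004, Def. 1.2.2] -/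
theorem KSDatum.mk_eq_of_mk_eq (hLU : L = U) (fs : A →+ A ⧸ U) {θ : L ≃+ A ⧸ L}
    (hθ : ∀ y : L, θ y = QuotientAddGroup.quotientAddEquivOfEq hLU.symm (fs y)) {a : A} {y : L}
    (h : (a : A ⧸ U) = fs y) : (a : A ⧸ L) = θ y := by
  rw [hθ, ← h, QuotientAddGroup.quotientAddEquivOfEq_mk]

end Transport

/-! ### §2 The datum from THE comparison map at a good `vℓ ∤ p` -/

section FromComparison

variable (W : WeierstrassCurve ℚ) [W.IsElliptic] {N : ℕ} (f : CuspForm (Gamma0 N) 2)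
  (p ℓ k n : ℕ) [Fact p.Prime] [Fact ℓ.Prime] (Q : W.toAffine.Point) (vℓ vp : HeightOneSpectrum (𝓞 ℚ))
  (ψ : (q : ℕ) → (ZMod q)ˣ →* Multiplicative (ZMod (p ^ k)))

/-- **`KolyvaginKimDatum` from THE comparison map.** At a finite place `vℓ ∤ p` of good reduction (so that the local
Kummer condition `𝓛_{vℓ}` of `E[p^n]` is `H¹_ur(ℚ_{vℓ}, E[p^n])`, AEC X.4.4), let
`fs : H¹(ℚ_{vℓ}, E[p^n]) → H¹(ℚ_{vℓ}, E[p^n]) ⧸ H¹_ur` be ANY additive map bijective on `H¹_ur` (an admissible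
finite–singular comparison map `φ^{fs}_ℓ`). If `x ∈ H¹(ℚ, E[p^n])` is Kummer outside `{vℓ, vp}`, satisfies the KS
relation `loc^s_{vℓ} x = fs(loc_{vℓ} κ_{p^n}(Q))` (Mazur–Rubin Def. 3.1.3 / Kim §2.2.2 with `κ_1 = κ(Q)`), and has Kim's
reading at `vp`, then `KolyvaginKimDatum W f p ℓ k n Q vℓ vp ψ` holds — its `θ` being THE transport of `fs`.
[cite: MazurRubin2004, Def. 1.2.2, Lemma 1.2.3 and Def. 3.2.1] [cite: Kim2022StructureSelmer, §2.2.2 and Thm. 3.13]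
[cite: SilvermanAEC2009, Cor. X.4.4] -/
theorem kolyvaginKimDatum_of_singularMap_eq (hpv : ((p : ℕ) : 𝓞 ℚ) ∉ vℓ.asIdeal) (hgood : W.HasGoodReductionAt vℓ)
    (fs : galoisCohomology (GaloisRep.toLocal vℓ (W.torsionGaloisModule ((p ^ n : ℕ) : ℤ))) 1 →+
      SingularQuotient (GaloisRep.toLocal vℓ (W.torsionGaloisModule ((p ^ n : ℕ) : ℤ))))
    (hbij : Function.Bijective fun y : unramifiedSubgroup
      (GaloisRep.toLocal vℓ (W.torsionGaloisModule ((p ^ n : ℕ) : ℤ))) 1 => fs y)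
    {x : galoisCohomology (W.torsionGaloisModule ((p ^ n : ℕ) : ℤ)) 1}
    (hx : x ∈ kummerOutside W (p ^ n) {Sum.inr vℓ, Sum.inr vp})
    (hKS : singularMap (GaloisRep.toLocal vℓ (W.torsionGaloisModule ((p ^ n : ℕ) : ℤ)))
        (galoisCohomology.localization (W.torsionGaloisModule (p ^ n : ℕ)) (Sum.inr vℓ) 1 x) =
      fs (galoisCohomology.localization (W.torsionGaloisModule (p ^ n : ℕ)) (Sum.inr vℓ) 1
        (kummerMapTorsion W (p ^ n)
          (W.zsmul_geomPoints_surjective_holds (Int.natCast_ne_zero.mpr (NeZero.ne (p ^ n)))) Q)))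
    (hkim : ∀ ψp : galoisCohomology ((W.torsionGaloisModule (p ^ n : ℕ)).toLocal (Sum.inr vp)) 1 ⧸
        W.kummerSelmerStructure ((p ^ n : ℕ) : ℤ) (Sum.inr vp) ≃+ ZMod (p ^ n),
      (haveI : NeZero ℓ := ⟨(Fact.out : ℓ.Prime).ne_zero⟩
       zmodPowOrd p k (kuriharaNumber f (p ^ k) ℓ ψ)) =
        min k (zmodPowOrd p n
          (ψp (galoisCohomology.localization (W.torsionGaloisModule (p ^ n : ℕ)) (Sum.inr vp) 1 x)))) :
    KolyvaginKimDatum W f p ℓ k n Q vℓ vp ψ := by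
  have hLU := X11b.KummerPT.kummerSelmerStructure_inr_eq_unramifiedSubgroup W p n hpv hgood
  obtain ⟨θ, hθ⟩ := KSDatum.exists_addEquiv_transport hLU fs hbij
  exact ⟨x, hx, θ, KSDatum.mk_eq_of_mk_eq hLU fs hθ hKS, hkim⟩

end FromComparison

/-! ### §3 The datum from a KOLYVAGIN SYSTEM of the tree (`KolyvaginDatum.IsKolyvaginSystem`) -/

section FromKolyvaginSystem

variable (W : WeierstrassCurve ℚ) [W.IsElliptic] {N : ℕ} (f : CuspForm (Gamma0 N) 2)
  (p ℓ k n : ℕ) [Fact p.Prime] [Fact ℓ.Prime] (Q : W.toAffine.Point) (vℓ vp : HeightOneSpectrum (𝓞 ℚ))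
  (ψ : (q : ℕ) → (ZMod q)ˣ →* Multiplicative (ZMod (p ^ k)))

omit [W.IsElliptic] [Fact p.Prime] in
/-- **The class `κ_{ℓ}` of a Kolyvagin system is Kummer outside `{vℓ, vp}`** as soon as the Selmer structure `𝓕` is
Kummer-or-finer at every place `∉ {vℓ, vp}`: `κ_{ℓ} ∈ H¹_{𝓕(ℓ)}` and `𝓕(ℓ)_v = 𝓕_v ≤ 𝓛_v` there (the transverse
modification touches only `vℓ`). [cite: MazurRubin2004, Def. 3.1.3 and Def. 3.2.1] [cite: Sakamoto2024, Def. 4.1 (p. 926)] -/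
theorem mem_kummerOutside_of_isKolyvaginSystem
    {D : KolyvaginDatum (W.torsionGaloisModule ((p ^ n : ℕ) : ℤ))} (hDℓ : vℓ ∈ D.primes)
    {𝓕 : SelmerStructure (W.torsionGaloisModule ((p ^ n : ℕ) : ℤ))}
    (h𝓕 : ∀ v : Place ℚ, v ≠ Sum.inr vℓ → v ≠ Sum.inr vp → 𝓕 v ≤ W.kummerSelmerStructure ((p ^ n : ℕ) : ℤ) v)
    {κ : Finset (HeightOneSpectrum (𝓞 ℚ)) → galoisCohomology (W.torsionGaloisModule ((p ^ n : ℕ) : ℤ)) 1}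
    (hκ : D.IsKolyvaginSystem 𝓕 κ) :
    κ {vℓ} ∈ kummerOutside W (p ^ n) {Sum.inr vℓ, Sum.inr vp} := by
  have hlev : D.IsLevel {vℓ} := by
    simpa [KolyvaginDatum.IsLevel] using hDℓ
  have hsel := (SelmerStructure.mem_selmerGroup_iff _ _).mp (hκ.mem_selmerGroup {vℓ} hlev)
  rw [mem_kummerOutside_iff]
  intro v hv
  have hvℓ' : v ≠ Sum.inr vℓ := fun h => hv (by rw [h]; simp)
  have hvp' : v ≠ Sum.inr vp := fun h => hv (by rw [h]; simp)
  have hat : D.atLevel 𝓕 {vℓ} v = 𝓕 v := by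
    cases v with
    | inl w => rfl
    | inr q =>
      have hq : q ∉ ({vℓ} : Finset (HeightOneSpectrum (𝓞 ℚ))) := by
        rw [Finset.mem_singleton]
        rintro rfl
        exact hvℓ' rfl
      exact SelmerStructure.modify_inr_of_not_mem _ _ (Finset.notMem_empty q) (Finset.notMem_empty q) hq
  have hloc := hsel v
  rw [hat] at hloc
  exact h𝓕 v hvℓ' hvp' hloc

/-- **`KolyvaginKimDatum` from a Kolyvagin system.** Let `D` be a Kolyvagin datum on `E[p^n]` (primes `𝒫`,
transverse conditions, comparison maps `φ^{fs}`) with `vℓ ∈ 𝒫` and `φ^{fs}_{vℓ}` bijective on `H¹_ur` (admissible at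
`vℓ`); `vℓ ∤ p` of good reduction; `𝓕` a Selmer structure Kummer-or-finer off `{vℓ, vp}` (the shape of `𝓕_can`); and
`κ` a KOLYVAGIN SYSTEM for `(E[p^n], 𝓕, D)` (`IsKolyvaginSystem`: `κ_d ∈ H¹_{𝓕(d)}`, `v_𝔮(κ_{d𝔮}) = φ^{fs}_𝔮(κ_d)`) whose
bottom class is the Kummer class of the point, `κ_1 = κ_{p^n}(Q)` (Mazur–Rubin Thm. 5.2.12: `κ_1 = p^a u·P`). If the
class `κ_{ℓ}` has Kim's reading at `vp` (Thm. 3.13 + (5.3)), then `KolyvaginKimDatum W f p ℓ k n Q vℓ vp ψ`.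
[cite: MazurRubin2004, Def. 3.1.3, Thm. 3.2.4 and Thm. 5.2.12] [cite: Kim2022StructureSelmer, §2.2.2 and Thm. 3.13]
[cite: Sakamoto2024, Def. 4.1 (p. 926)] -/
theorem kolyvaginKimDatum_of_isKolyvaginSystem (hpv : ((p : ℕ) : 𝓞 ℚ) ∉ vℓ.asIdeal)
    (hgood : W.HasGoodReductionAt vℓ)
    {D : KolyvaginDatum (W.torsionGaloisModule ((p ^ n : ℕ) : ℤ))} (hDℓ : vℓ ∈ D.primes)
    (hbij : Function.Bijective fun y : unramifiedSubgroup
      (GaloisRep.toLocal vℓ (W.torsionGaloisModule ((p ^ n : ℕ) : ℤ))) 1 => D.fs vℓ y)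
    {𝓕 : SelmerStructure (W.torsionGaloisModule ((p ^ n : ℕ) : ℤ))}
    (h𝓕 : ∀ v : Place ℚ, v ≠ Sum.inr vℓ → v ≠ Sum.inr vp → 𝓕 v ≤ W.kummerSelmerStructure ((p ^ n : ℕ) : ℤ) v)
    {κ : Finset (HeightOneSpectrum (𝓞 ℚ)) → galoisCohomology (W.torsionGaloisModule ((p ^ n : ℕ) : ℤ)) 1}
    (hκ : D.IsKolyvaginSystem 𝓕 κ)
    (h1 : κ ∅ = kummerMapTorsion W (p ^ n)
      (W.zsmul_geomPoints_surjective_holds (Int.natCast_ne_zero.mpr (NeZero.ne (p ^ n)))) Q)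
    (hkim : ∀ ψp : galoisCohomology ((W.torsionGaloisModule (p ^ n : ℕ)).toLocal (Sum.inr vp)) 1 ⧸
        W.kummerSelmerStructure ((p ^ n : ℕ) : ℤ) (Sum.inr vp) ≃+ ZMod (p ^ n),
      (haveI : NeZero ℓ := ⟨(Fact.out : ℓ.Prime).ne_zero⟩
       zmodPowOrd p k (kuriharaNumber f (p ^ k) ℓ ψ)) =
        min k (zmodPowOrd p n
          (ψp (galoisCohomology.localization (W.torsionGaloisModule (p ^ n : ℕ)) (Sum.inr vp) 1 (κ {vℓ}))))) :
    KolyvaginKimDatum W f p ℓ k n Q vℓ vp ψ := by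
  have hx := mem_kummerOutside_of_isKolyvaginSystem W p n vℓ vp hDℓ h𝓕 hκ
  have hKS := hκ.fs_rel ∅ D.isLevel_empty vℓ hDℓ (Finset.notMem_empty vℓ)
  rw [Finset.insert_empty, h1] at hKS
  exact kolyvaginKimDatum_of_singularMap_eq W f p ℓ k n Q vℓ vp ψ hpv hgood (D.fs vℓ) hbij hx hKS hkim

/-- The same with the tree's `KolyvaginDatum.IsAdmissible` (bijectivity of `φ^{fs}_𝔮` on `H¹_ur` at EVERY `𝔮 ∈ 𝒫` —
Mazur–Rubin Lemma 1.2.3, a theorem of the tree for the canonical maps at Sakamoto's primes).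
[cite: MazurRubin2004, Lemma 1.2.3 and Thm. 3.2.4] [cite: Kim2022StructureSelmer, Thm. 3.13] -/
theorem kolyvaginKimDatum_of_isKolyvaginSystem_of_isAdmissible (hpv : ((p : ℕ) : 𝓞 ℚ) ∉ vℓ.asIdeal)
    (hgood : W.HasGoodReductionAt vℓ)
    {D : KolyvaginDatum (W.torsionGaloisModule ((p ^ n : ℕ) : ℤ))} (hDℓ : vℓ ∈ D.primes) (hadm : D.IsAdmissible)
    {𝓕 : SelmerStructure (W.torsionGaloisModule ((p ^ n : ℕ) : ℤ))}
    (h𝓕 : ∀ v : Place ℚ, v ≠ Sum.inr vℓ → v ≠ Sum.inr vp → 𝓕 v ≤ W.kummerSelmerStructure ((p ^ n : ℕ) : ℤ) v)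
    {κ : Finset (HeightOneSpectrum (𝓞 ℚ)) → galoisCohomology (W.torsionGaloisModule ((p ^ n : ℕ) : ℤ)) 1}
    (hκ : D.IsKolyvaginSystem 𝓕 κ)
    (h1 : κ ∅ = kummerMapTorsion W (p ^ n)
      (W.zsmul_geomPoints_surjective_holds (Int.natCast_ne_zero.mpr (NeZero.ne (p ^ n)))) Q)
    (hkim : ∀ ψp : galoisCohomology ((W.torsionGaloisModule (p ^ n : ℕ)).toLocal (Sum.inr vp)) 1 ⧸
        W.kummerSelmerStructure ((p ^ n : ℕ) : ℤ) (Sum.inr vp) ≃+ ZMod (p ^ n),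
      (haveI : NeZero ℓ := ⟨(Fact.out : ℓ.Prime).ne_zero⟩
       zmodPowOrd p k (kuriharaNumber f (p ^ k) ℓ ψ)) =
        min k (zmodPowOrd p n
          (ψp (galoisCohomology.localization (W.torsionGaloisModule (p ^ n : ℕ)) (Sum.inr vp) 1 (κ {vℓ}))))) :
    KolyvaginKimDatum W f p ℓ k n Q vℓ vp ψ :=
  kolyvaginKimDatum_of_isKolyvaginSystem W f p ℓ k n Q vℓ vp ψ hpv hgood hDℓ (hadm vℓ hDℓ) h𝓕 hκ h1 hkim

omit [W.IsElliptic] [Fact p.Prime] in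
/-- **The Kummer structure relaxed at `vp` is Kummer-or-finer off `{vℓ, vp}`** (trivially: it IS Kummer there). This is
`𝓕_can` of `E[p^n]` in Kummer currency (no condition at `p`, the Kummer image = `H¹_f ⊗` elsewhere), the structure for
which Kato's classes form a Kolyvagin system. [cite: MazurRubin2004, Def. 3.2.1 and §6.2] -/
theorem kummerSelmerStructure_relaxedAt_le (v : Place ℚ) (hvp : v ≠ Sum.inr vp) :
    (W.kummerSelmerStructure ((p ^ n : ℕ) : ℤ)).relaxedAt {vp} v ≤ W.kummerSelmerStructure ((p ^ n : ℕ) : ℤ) v := by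
  cases v with
  | inl w => exact le_rfl
  | inr q =>
    have hq : q ∉ ({vp} : Finset (HeightOneSpectrum (𝓞 ℚ))) := by
      rw [Finset.mem_singleton]; rintro rfl; exact hvp rfl
    rw [SelmerStructure.relaxedAt, SelmerStructure.modify_inr_of_not_mem _ _ hq (Finset.notMem_empty q)
      (Finset.notMem_empty q)]

/-- **`KolyvaginKimDatum` from a Kolyvagin system for the Kummer structure relaxed at `p`** (`𝓕_can` in Kummer
currency): the hypothesis `h𝓕` of `kolyvaginKimDatum_of_isKolyvaginSystem` discharged.
[cite: MazurRubin2004, Def. 3.2.1, Thm. 3.2.4 and Thm. 5.2.12] [cite: Kim2022StructureSelmer, Thm. 3.13] -/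
theorem kolyvaginKimDatum_of_isKolyvaginSystem_kummer (hpv : ((p : ℕ) : 𝓞 ℚ) ∉ vℓ.asIdeal)
    (hgood : W.HasGoodReductionAt vℓ)
    {D : KolyvaginDatum (W.torsionGaloisModule ((p ^ n : ℕ) : ℤ))} (hDℓ : vℓ ∈ D.primes)
    (hbij : Function.Bijective fun y : unramifiedSubgroup
      (GaloisRep.toLocal vℓ (W.torsionGaloisModule ((p ^ n : ℕ) : ℤ))) 1 => D.fs vℓ y)
    {κ : Finset (HeightOneSpectrum (𝓞 ℚ)) → galoisCohomology (W.torsionGaloisModule ((p ^ n : ℕ) : ℤ)) 1}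
    (hκ : D.IsKolyvaginSystem ((W.kummerSelmerStructure ((p ^ n : ℕ) : ℤ)).relaxedAt {vp}) κ)
    (h1 : κ ∅ = kummerMapTorsion W (p ^ n)
      (W.zsmul_geomPoints_surjective_holds (Int.natCast_ne_zero.mpr (NeZero.ne (p ^ n)))) Q)
    (hkim : ∀ ψp : galoisCohomology ((W.torsionGaloisModule (p ^ n : ℕ)).toLocal (Sum.inr vp)) 1 ⧸
        W.kummerSelmerStructure ((p ^ n : ℕ) : ℤ) (Sum.inr vp) ≃+ ZMod (p ^ n),
      (haveI : NeZero ℓ := ⟨(Fact.out : ℓ.Prime).ne_zero⟩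
       zmodPowOrd p k (kuriharaNumber f (p ^ k) ℓ ψ)) =
        min k (zmodPowOrd p n
          (ψp (galoisCohomology.localization (W.torsionGaloisModule (p ^ n : ℕ)) (Sum.inr vp) 1 (κ {vℓ}))))) :
    KolyvaginKimDatum W f p ℓ k n Q vℓ vp ψ :=
  kolyvaginKimDatum_of_isKolyvaginSystem W f p ℓ k n Q vℓ vp ψ hpv hgood hDℓ hbij
    (fun v _ hvp => kummerSelmerStructure_relaxedAt_le W p n vp v hvp) hκ h1 hkim

end FromKolyvaginSystem

/-! ### §4 The closed sentence: C-16 ⟸ Poitou–Tate ∧ local Euler characteristic ∧ a Kolyvagin system on every letter -/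

section Closed

/-- At the place `vℓ ∋ ℓ` of a Kolyvagin prime `ℓ ∈ 𝒫_n` of `(E, p)`: `vℓ ∤ p` and `E` has good reduction at `vℓ`
(`ℓ ∤ N·p`). [cite: Kim2022StructureSelmer, §1.2.2] -/
theorem IsKolyvaginPrime.not_mem_and_hasGoodReductionAt (W : WeierstrassCurve ℚ) [W.IsElliptic]
    [W.IsGloballyMinimal] {p n ℓ : ℕ} [Fact p.Prime] (hKP : Kato.IsKolyvaginPrime W p n ℓ)
    {vℓ : HeightOneSpectrum (𝓞 ℚ)} (hvℓ : (ℓ : 𝓞 ℚ) ∈ vℓ.asIdeal) :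
    ((p : ℕ) : 𝓞 ℚ) ∉ vℓ.asIdeal ∧ W.HasGoodReductionAt vℓ := by
  have hℓ : ℓ.Prime := hKP.prime
  have hgen : (Rat.HeightOneSpectrum.primesEquiv vℓ : ℕ) = ℓ := Rat.HeightOneSpectrum.primesEquiv_eq_of_natCast_mem vℓ hℓ hvℓ
  refine ⟨fun hp => hKP.ne ?_, ?_⟩
  · have h1 := (natCast_mem_asIdeal_iff_eq_primesEquiv_symm vℓ hℓ).mp hvℓ
    have h2 := (natCast_mem_asIdeal_iff_eq_primesEquiv_symm vℓ (Fact.out : p.Prime)).mp hp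
    have h3 := h1.symm.trans h2
    have h4 := congrArg (fun q : Nat.Primes => (q : ℕ)) (Rat.HeightOneSpectrum.primesEquiv.symm.injective h3)
    exact h4
  · exact hasGoodReductionAt_of_not_dvd_conductorNorm W vℓ (by rw [hgen]; exact hKP.not_dvd_conductorNorm)

/-- **C-16 (closed sentence) ⟸ Poitou–Tate over `ℚ` ∧ local Euler characteristic at every `ℚ_v` ∧, on C-16's letter,
a KOLYVAGIN SYSTEM with Kim's reading**: for every curve/point/letter as in
`kuriharaExactOrderRankOneAtThree_of_kolyvaginKimDatum` and every surjective `ψ` there are a depth `n ≥ k` with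
`ℓ ∈ 𝒫_n`, a unit `u` (`3 ∤ u`), a Kolyvagin datum `D` on `E[3^n]` with `vℓ ∈ 𝒫` whose `φ^{fs}_{vℓ}` is bijective on
`H¹_ur`, a Selmer structure `𝓕` Kummer-or-finer off `{vℓ, v₃}`, and a Kolyvagin system `κ ∈ KS(E[3^n], 𝓕, D)` with
`κ_1 = κ((3^F·u)·P)` (`F = s + v₃ ∏ c_q`) whose class `κ_{ℓ}` has Kim's reading at `v₃` — the ONE open input in the
vocabulary of Mazur–Rubin Thm. 3.2.4 / 5.2.12 (Kato's Euler system) and Kim Thm. 3.13, printed for `p ≥ 5`, OPEN at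
`p = 3`. Nothing asserted; C-16 stays a CONJECTURE. [cite: MazurRubin2004, Thm. 3.2.4 and Thm. 5.2.12]
[cite: Kim2022StructureSelmer, Thm. 3.13 and (5.3)] [cite: MilneADT2006, Ch. I, Thm. 4.10(b) and Thm. 2.8] -/
theorem kuriharaExactOrderRankOneAtThree_of_isKolyvaginSystem
    (hPT : poitouTate_sum_localTatePairing_eq_zero ℚ)
    (hEP : ∀ v : HeightOneSpectrum (𝓞 ℚ), localEulerPoincareCharacteristic (v.adicCompletion ℚ))
    (hcore : ∀ (W : WeierstrassCurve ℚ) [W.IsElliptic] [W.IsGloballyMinimal],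
      W.analyticRank = 1 →
      ∀ (P : W.toAffine.Point), ¬ IsOfFinAddOrder P →
        (∀ Q : W.toAffine.Point, ∃ n : ℤ, IsOfFinAddOrder (Q - n • P)) →
      (∀ T : W.toAffine.Point, 3 • T = 0 → T = 0) →
      W.HasSurjectiveModNGaloisRep 3 →
      W.HasGoodReductionAtPrime 3 → W.frobeniusTrace 3 ≠ 1 → W.frobeniusTrace 3 ≠ -2 →
      ¬ O5.PointLocallyThreeDivisibleAt W 3 P →
      ∀ (q : ℚ) (s : ℕ), shaAn W = (q : ℂ) → padicValRat 3 q = s →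
      ∀ {N : ℕ} [NeZero N] (D : ModularParametrizationData W N),
        ¬ (3 : ℤ) ∣ D.maninConstant →
        (∃ u : ℚ, ‖(u : ℚ_[3])‖ = 1 ∧ W.realPeriodRat = u * plusPeriod D.f) →
      ∀ (ℓ k : ℕ) [Fact ℓ.Prime], 1 ≤ k → Kato.IsKolyvaginPrime W 3 k ℓ →
        IsCyclicKolyvaginLevel W 3 ℓ →
      ∀ (vℓ v₃ : HeightOneSpectrum (𝓞 ℚ)), (ℓ : 𝓞 ℚ) ∈ vℓ.asIdeal → ((3 : ℕ) : 𝓞 ℚ) ∈ v₃.asIdeal →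
        ∀ ψ : (q : ℕ) → (ZMod q)ˣ →* Multiplicative (ZMod (3 ^ k)),
          (∀ q ∈ ℓ.primeFactors, Function.Surjective (ψ q)) →
            ∃ (n : ℕ) (_ : k ≤ n) (_ : Kato.IsKolyvaginPrime W 3 n ℓ) (u : ℕ) (_ : ¬ 3 ∣ u)
              (KD : KolyvaginDatum (W.torsionGaloisModule ((3 ^ n : ℕ) : ℤ))) (_ : vℓ ∈ KD.primes)
              (_ : Function.Bijective fun y : unramifiedSubgroup
                (GaloisRep.toLocal vℓ (W.torsionGaloisModule ((3 ^ n : ℕ) : ℤ))) 1 => KD.fs vℓ y)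
              (𝓕 : SelmerStructure (W.torsionGaloisModule ((3 ^ n : ℕ) : ℤ)))
              (_ : ∀ v : Place ℚ, v ≠ Sum.inr vℓ → v ≠ Sum.inr v₃ →
                𝓕 v ≤ W.kummerSelmerStructure ((3 ^ n : ℕ) : ℤ) v)
              (κ : Finset (HeightOneSpectrum (𝓞 ℚ)) → galoisCohomology (W.torsionGaloisModule ((3 ^ n : ℕ) : ℤ)) 1)
              (_ : KD.IsKolyvaginSystem 𝓕 κ)
              (_ : κ ∅ = kummerMapTorsion W (3 ^ n)
                (W.zsmul_geomPoints_surjective_holds (Int.natCast_ne_zero.mpr (NeZero.ne (3 ^ n))))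
                ((3 ^ (s + padicValNat 3 W.tamagawaProduct) * u) • P)),
              ∀ ψp : galoisCohomology ((W.torsionGaloisModule (3 ^ n : ℕ)).toLocal (Sum.inr v₃)) 1 ⧸
                  W.kummerSelmerStructure ((3 ^ n : ℕ) : ℤ) (Sum.inr v₃) ≃+ ZMod (3 ^ n),
                (haveI : NeZero ℓ := ⟨(Fact.out : ℓ.Prime).ne_zero⟩
                 zmodPowOrd 3 k (kuriharaNumber D.f (3 ^ k) ℓ ψ)) =
                  min k (zmodPowOrd 3 n (ψp (galoisCohomology.localization
                    (W.torsionGaloisModule (3 ^ n : ℕ)) (Sum.inr v₃) 1 (κ {vℓ}))))) :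
    KuriharaExactOrderRankOneAtThree :=
  haveI : Fact (Nat.Prime 3) := ⟨Nat.prime_three⟩
  kuriharaExactOrderRankOneAtThree_of_kolyvaginKimDatum hPT hEP
    fun W _ _ hr P hP hgen htors hsurj hgood ha1 ha2 hm0 q s hq hs N _ D hManin hper ℓ k _ hk hKP hcyc vℓ v₃ hvℓ hv₃
      ψ hψ => by
      obtain ⟨n, hkn, hKPn, u, hu, KD, hDℓ, hbij, 𝓕, h𝓕, κ, hκ, h1, hkim⟩ :=
        hcore W hr P hP hgen htors hsurj hgood ha1 ha2 hm0 q s hq hs D hManin hper ℓ k hk hKP hcyc vℓ v₃ hvℓ hv₃ ψ hψ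
      obtain ⟨hpv, hgoodℓ⟩ := IsKolyvaginPrime.not_mem_and_hasGoodReductionAt W hKPn hvℓ
      exact ⟨n, hkn, hKPn, u, hu, kolyvaginKimDatum_of_isKolyvaginSystem W D.f 3 ℓ k n _ vℓ v₃ ψ hpv hgoodℓ hDℓ hbij
        h𝓕 hκ h1 hkim⟩

end Closed

end Summit.BirchSwinnertonDyer.Rank1Residual.Ordinary

end
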